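/-
Copyright (c) 2026 the pub-hodgecm-mathlib formalisation cell (harness21).  Prover seat hodgecm-mathlib-LH10-p02 (g14), 2026-09-03.  E1 row 55 «HOROCYCLE ∕ HEIGHT
GEOMETRY OF THE U(3) TREE AT THE DATUM», file A-I-1 «HOROCYCLE STEPS: THE ROOT STAR» (keeper F0P3a-p03 (g30) 03:20:54Z; census `CENSUS-R55.v1` c3e3dfd81a9bbf59).
-/
import Literature.NumberTheory.Automorphic.UnitaryLatticeTreeGeodesicApartment     -- ★ 39γ (F0P3a-p01): the enumerated apartment `A`, `coe_apartmentEnum_zero`, `exists_coe_eq_diagonal_zpow`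
import Literature.NumberTheory.Automorphic.UnitaryLatticeTreeRootStarOrbit          -- ★ V2a (B-p14): `exists_isotropic_forall_mem_iff_of_mem_neighborSet_root`
import Literature.NumberTheory.Automorphic.UnitaryLatticeTreeTypeTwoStarCount       -- ★ V3 (B-p14): `mem_neighborSet_N₁_iff_exists_vec`
import Literature.NumberTheory.Automorphic.UnitaryLatticeTreeStabilizer             -- ★ T1b (B-p14): `mapGL_stdLattice_eq_iff`
import Literature.NumberTheory.Automorphic.UnitaryLatticeTreeFixedChildCountTransportRamified  -- ★ p847251 (F0P2-p01): `latticeGraphIso_mul_apply ∕ _one_apply ∕ _mul_inv_apply ∕ _inv_mul_apply`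
import Literature.NumberTheory.Automorphic.UnitaryThreeSingularUnipotentClasses     -- ★ `mem_unitaryGroupOfForm_iff_of_coe_eq_upperUnipotent`, `B₀_three_apply`
import Literature.NumberTheory.Automorphic.UnitaryGroupBorelInduction               -- ★ `unipotentU`, `torusU`, `borelU_le_normalizer`
import HarnessLib
/-!
# Horocycle steps of the unramified `U(3)` tree, I: the torus on the enumerated apartment, and the ROOT STAR as one horocycle step —
# `star(A 0) = {A (−1)} ⊔ (N ∩ Stab(A 0)) · A 1` (Bruhat–Tits 1972 §10, (4.4.4); Serre, *Trees* II.1.1; Rogawski 1990 §1.10)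

THE SETTING (common to the three files A-I-1∕2∕3).  `K` a valued field, `σ` an isometric involution, `ϖ` a `σ`-fixed uniformiser (`hd`), `J₀ = antidiag(1,1,1)`, `U = U(σ, J₀)`
acting on the lattice tree by ★ `latticeGraphIso`; `B ≥ T, N` the upper-triangular Borel subgroup of `U`, its diagonal torus and its unipotent radical (★ `UnitaryGroup.borelU ∕
torusU ∕ unipotentU`; `B` is the stabiliser of the isotropic line `K e₀`).  The standard apartment is the bi-infinite path `A : ℤ → 𝓥` (HYPOTHESIS-STYLE `(A, hA0, hA1)` exactly as in
★ `UnitaryLatticeTreeGeodesicApartment` §Enum, supplied by ★ `exists_apartmentEnum`): `A (2a) = latt diag(ϖ^a, 1, ϖ^{-a})` (self-dual), `A (2a+1) = latt diag(ϖ^{a+1}, 1, ϖ^{-a})`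
(type two).  Cell `pub/hodgecm-mathlib` (D-0151), crux H413 = `stmt-HodgeConjecture-24833`, lane `--supports`; E1 BRICK LEDGER row 55 «HOROCYCLE ∕ HEIGHT GEOMETRY OF THE `U(3)` TREE
AT THE DATUM» (keeper F0P3a-p03 (g30) 03:20:54Z), file A-I «HOROCYCLE STEPS» of `CENSUS-R55.v1` (c3e3dfd81a9bbf59; the missing brick H «the `N`-orbits are the horospheres and the
standard apartment is a transversal», heads (T)(T′)(H1)–(H4); (H5)–(H8) = file A-II `UnitaryLatticeTreeHorosphereTransversal`, LH5-p05 (g12)), cut in three by the 400-line rule: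
A-I-1 `…HorocycleRootStar` ((T)(T′)(H2)), A-I-2 `…HorocycleTypeTwoStar` ((H3)), A-I-3 `…HorocycleSteps` ((H1)(H4), the head).  Topic `NumberTheory/Automorphic`; namespace
`Literature.NumberTheory.Automorphic.UnitaryLatticeTree`.  THEOREMS ONLY (no definition, no instance, no notation, no named fact, no `sorry`).
HONEST LABEL: count-neutral generic lattice-tree layer at an UNRAMIFIED datum `hd : UnramifiedLocalConjDatum σ ϖ` ((R-SS) banked as a PAYDOWN-UNR road for K1 only; E1 =
PRINT); HC_CM is proved only modulo the 7 printed citations (2 remaining named inputs hLiu418 = `stmt-HodgeConjecture-24832`, h413 = `stmt-HodgeConjecture-24833`) until rung 0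
closes; nothing printed is asserted here — elementary lattice algebra over a valued field.

THIS FILE.
* §0 bookkeeping: `T` conjugates `N` into `N` (`conj_mem_unipotentU_of_mem_torusU'`); valuation and `𝒪`-submodule one-liners (the vertex action lemmas
  `latticeGraphIso_mul_apply ∕ _one_apply ∕ _mul_inv_apply ∕ _inv_mul_apply` are ★ `UnitaryLatticeTreeFixedChildCountTransportRamified`, imported);
  **(T)** `exists_mem_torusU_latticeGraphIso_apartmentEnum_eq_add`: `t_c = diag(ϖ^c, 1, ϖ^{-c}) ∈ T` translates `A j ↦ A (j + 2c)`;
  **(T′)** `latticeGraphIso_apartmentEnum_eq_self_of_unit_diagonal`: a diagonal element with unit entries fixes every `A j` (★ `UnitaryLatticeTreeApartmentTorus` in `A`-currency).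
* §2 **(H2)** `exists_mem_unipotentU_apply_apartmentEnum_one_eq_of_adj_zero` — THE ROOT STAR AS ONE HOROCYCLE STEP: a neighbour `y ≠ A (−1)` of `A 0 = 𝒪³` is `n · A 1` for some
  `n ∈ N` fixing `A 0`.  By ★ V2a `y = N_x = {y ∈ 𝒪³ | B₀(x, y) ∈ 𝔪}` for an integral primitive exactly isotropic `x`; `|x₂| < 1` forces `N_x = N_{e₀} = A (−1)`, and for `|x₂| = 1`
  the Heisenberg element with last column `x ∕ x₂` (unitary by ★ `mem_unitaryGroupOfForm_iff_of_coe_eq_upperUnipotent`) carries `A 1 = N_{e₂} = latt diag(ϖ,1,1)` onto `N_x`.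

## References
* [BruhatTits1972] F. Bruhat, J. Tits, *Groupes réductifs sur un corps local I*, Publ. Math. IHÉS 41 (1972), §10 (lattice models of the rank-one unitary building), (4.4.4)
  (the stabiliser of a vertex is transitive on the chambers containing it), (7.4.18).
* [Serre1980Trees] J.-P. Serre, *Trees* (1980), Ch. II §1.1 (the tree of `SL₂`: lattices, the apartment of diagonal lattices, the action of unipotent matrices), Ch. I §2.
* [Rogawski1990] J. D. Rogawski, *Automorphic Representations of Unitary Groups in Three Variables*, Ann. of Math. Stud. 123 (1990), §1.10 p. 9 (`B = MN`, `N = {u(x, z)}`,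
  `d(α, β, ᾱ⁻¹)`), §4.5 p. 45 (Iwasawa decomposition).
-/

set_option autoImplicit false

open scoped Valued WithZero Matrix MatrixGroups

namespace Literature.NumberTheory.Automorphic.UnitaryLatticeTree

open _root_.SimpleGraph Literature.NumberTheory.Automorphic Literature.NumberTheory.Automorphic.HermitianLattice
open Literature.NumberTheory.Automorphic.CartanUnique (uniformizer_ne_zero uniformizer_mem_integer)
open Literature.NumberTheory.Automorphic.UnitaryGroup

variable {K : Type*} [Field K] [Valued K ℤᵐ⁰] {σ : K →+* K} {ϖ : K}
/-! ## §0 Bookkeeping: `T` normalises `N`; valuation and submodule one-liners; the torus on the enumerated apartment -/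

omit [Valued K ℤᵐ⁰] in
/-- Conjugates of `N` by `T` lie in `N` (`T ≤ B` normalises `N`). [cite: Rogawski1990, §1.10 p. 9] -/
theorem conj_mem_unipotentU_of_mem_torusU' {N : ℕ} {J : Matrix (Fin N) (Fin N) K} {t n : unitaryGroupOfForm σ J}
    (ht : t ∈ torusU σ J) (hn : n ∈ unipotentU σ J) : t * n * t⁻¹ ∈ unipotentU σ J :=
  (Subgroup.mem_normalizer_iff.1 (borelU_le_normalizer σ J (torusU_le_borelU σ J ht)) n).1 hn


/-! ### Valuation bookkeeping -/

/-- `|p + q| ≤ 1` for integral `p, q`. [cite: Serre1980Trees, II.1.1] -/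
theorem v_add_le_one_of_le {p q : K} (hp : Valued.v p ≤ 1) (hq : Valued.v q ≤ 1) : Valued.v (p + q) ≤ 1 :=
  (Valuation.map_add _ _ _).trans (max_le hp hq)

/-- `|p − q| ≤ 1` for integral `p, q`. [cite: Serre1980Trees, II.1.1] -/
theorem v_sub_le_one_of_le {p q : K} (hp : Valued.v p ≤ 1) (hq : Valued.v q ≤ 1) : Valued.v (p - q) ≤ 1 :=
  (Valuation.map_sub _ _ _).trans (max_le hp hq)

/-- `|p q| ≤ 1` for integral `p, q`. [cite: Serre1980Trees, II.1.1] -/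
theorem v_mul_le_one_of_le {p q : K} (hp : Valued.v p ≤ 1) (hq : Valued.v q ≤ 1) : Valued.v (p * q) ≤ 1 := by
  rw [map_mul]; exact mul_le_one' hp hq


/-- Splitting a vector along a line: if `x − r·w ∈ M` with `r` integral then `x ∈ M + 𝒪w`. [cite: Serre1980Trees, II.1.1] -/
theorem mem_sup_span_singleton_of_sub_smul_mem {N : ℕ} {M : Submodule 𝒪[K] (Fin N → K)} {w x : Fin N → K} (r : K) (hr : Valued.v r ≤ 1)
    (h : x - r • w ∈ M) : x ∈ M ⊔ Submodule.span 𝒪[K] {w} := by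
  rw [Submodule.mem_sup]
  refine ⟨x - r • w, h, (⟨r, hr⟩ : 𝒪[K]) • w, Submodule.smul_mem _ _ (Submodule.mem_span_singleton_self w), ?_⟩
  change x - r • w + r • w = x
  abel

/-- A line `𝒪w` lies in `M` as soon as `w ∈ M`. [cite: Serre1980Trees, II.1.1] -/
theorem span_singleton_le_of_mem {N : ℕ} {M : Submodule 𝒪[K] (Fin N → K)} {w : Fin N → K} (h : w ∈ M) : Submodule.span 𝒪[K] {w} ≤ M :=
  Submodule.span_le.2 (Set.singleton_subset_iff.2 h)

section Enum

variable (hd : UnramifiedLocalConjDatum σ ϖ)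
  (A : ℤ → {M : Submodule 𝒪[K] (Fin 3 → K) // IsVertex σ ϖ ((StdForm.antidiagonal 3).over K) M})
  (hA0 : ∀ a : ℤ, (A (2 * a)).1 = latt (Matrix.diagonal ![ϖ ^ a, (1 : K), ϖ ^ (-a)]))
  (hA1 : ∀ a : ℤ, (A (2 * a + 1)).1 = latt (Matrix.diagonal ![ϖ ^ (a + 1), (1 : K), ϖ ^ (-a)]))
include hd hA0 hA1

/-- **THE TORUS TRANSLATION `t_c = diag(ϖ^c, 1, ϖ^{-c}) ∈ T` SHIFTS THE ENUMERATED APARTMENT BY `2c`: `t_c · A j = A (j + 2c)`** (★ `exists_coe_eq_diagonal_zpow`, ★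
`mapGL_latt_apartment_selfDual_translate` ∕ `…_two_translate`). [cite: BruhatTits1972, §10] [cite: Serre1980Trees, II.1.1] [cite: Rogawski1990, §1.10 p. 9] -/
theorem exists_mem_torusU_latticeGraphIso_apartmentEnum_eq_add (c : ℤ) :
    ∃ t : unitaryGroupOfForm σ ((StdForm.antidiagonal 3).over K), t ∈ torusU σ ((StdForm.antidiagonal 3).over K) ∧
      ((t : GL (Fin 3) K) : Matrix (Fin 3) (Fin 3) K) = Matrix.diagonal ![ϖ ^ c, 1, ϖ ^ (-c)] ∧
      ∀ j : ℤ, latticeGraphIso σ ϖ ((StdForm.antidiagonal 3).over K) t (A j) = A (j + 2 * c) := by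
  have hϖ0 : ϖ ≠ 0 := uniformizer_ne_zero hd.vϖ
  obtain ⟨t, ht⟩ := exists_coe_eq_diagonal_zpow hd.σσ hd.σϖ hϖ0 c
  refine ⟨t, ?_, ht, fun j => ?_⟩
  · rw [mem_torusU_iff]
    refine ⟨![Units.mk0 (ϖ ^ c) (zpow_ne_zero c hϖ0), 1, Units.mk0 (ϖ ^ (-c)) (zpow_ne_zero (-c) hϖ0)], Units.ext ?_⟩
    rw [coe_glDiagonal, ht]
    ext i j
    fin_cases i <;> fin_cases j <;> simp
  · apply Subtype.ext
    change mapGL (t : GL (Fin 3) K) (A j).1 = (A (j + 2 * c)).1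
    obtain ⟨a, rfl | rfl⟩ := Int.even_or_odd' j
    · rw [show 2 * a + 2 * c = 2 * (a + c) by ring, hA0, hA0]
      exact mapGL_latt_apartment_selfDual_translate (t : GL (Fin 3) K) ϖ hϖ0 c a ht
    · rw [show 2 * a + 1 + 2 * c = 2 * (a + c) + 1 by ring, hA1, hA1, show -a = 1 - (a + 1) by ring, show -(a + c) = 1 - (a + 1 + c) by ring,
        show a + c + 1 = a + 1 + c by ring]
      exact mapGL_latt_apartment_two_translate (t : GL (Fin 3) K) ϖ hϖ0 c (a + 1) ht

/-- **A DIAGONAL ELEMENT WITH UNIT ENTRIES FIXES EVERY VERTEX OF THE APARTMENT** (the compact part of `T` fixes its apartment pointwise; ★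
`mapGL_latt_apartment_selfDual_of_units` ∕ `…_two_of_units`). [cite: BruhatTits1972, §10] [cite: Serre1980Trees, II.1.1] -/
theorem latticeGraphIso_apartmentEnum_eq_self_of_unit_diagonal (t : unitaryGroupOfForm σ ((StdForm.antidiagonal 3).over K)) (u s w : K)
    (ht : ((t : GL (Fin 3) K) : Matrix (Fin 3) (Fin 3) K) = Matrix.diagonal ![u, s, w]) (hu : Valued.v u = 1) (hs : Valued.v s = 1) (hw : Valued.v w = 1) (j : ℤ) :
    latticeGraphIso σ ϖ ((StdForm.antidiagonal 3).over K) t (A j) = A j := by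
  have hϖ0 : ϖ ≠ 0 := uniformizer_ne_zero hd.vϖ
  apply Subtype.ext
  change mapGL (t : GL (Fin 3) K) (A j).1 = (A j).1
  obtain ⟨a, rfl | rfl⟩ := Int.even_or_odd' j
  · rw [hA0]
    exact mapGL_latt_apartment_selfDual_of_units (t : GL (Fin 3) K) u s w ϖ ht hu hs hw hϖ0 a
  · rw [hA1, show -a = 1 - (a + 1) by ring]
    exact mapGL_latt_apartment_two_of_units (t : GL (Fin 3) K) u s w ϖ ht hu hs hw hϖ0 (a + 1)

/-! ## §2 The root star as one horocycle step: `star(A 0) = {A (−1)} ⊔ (N ∩ Stab(A 0)) · A 1` -/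

/-- **THE ROOT STAR AS ONE HOROCYCLE STEP**: a neighbour `y` of the root `A 0 = 𝒪³` other than `A (−1) = N₁` is `n · A 1` for a unipotent upper-triangular `n ∈ N` fixing
`A 0`.  By ★ V2a `y = N_x = {y ∈ 𝒪³ | B₀(x, y) ∈ 𝔪}` with `x` integral, primitive, exactly isotropic; if `|x₂| < 1` isotropy forces `|x₁| < 1`, `|x₀| = 1` and `N_x = N₁ = A (−1)`;
if `|x₂| = 1` the Heisenberg element `n = u` with last column `x ∕ x₂` (unitary by ★ `mem_unitaryGroupOfForm_iff_of_coe_eq_upperUnipotent`, integral) has `n · N_{e₂} = N_{x}` and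
`N_{e₂} = latt diag(ϖ,1,1) = A 1`. [cite: BruhatTits1972, (4.4.4) and §10] [cite: Serre1980Trees, II.1.1] [cite: Rogawski1990, §1.10 p. 9] -/
theorem exists_mem_unipotentU_apply_apartmentEnum_one_eq_of_adj_zero
    {y : {M : Submodule 𝒪[K] (Fin 3 → K) // IsVertex σ ϖ ((StdForm.antidiagonal 3).over K) M}}
    (hy : (latticeGraph σ ϖ ((StdForm.antidiagonal 3).over K)).Adj (A 0) y) (hy' : y ≠ A (-1)) :
    ∃ n : unitaryGroupOfForm σ ((StdForm.antidiagonal 3).over K), n ∈ unipotentU σ ((StdForm.antidiagonal 3).over K) ∧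
      latticeGraphIso σ ϖ ((StdForm.antidiagonal 3).over K) n (A 0) = A 0 ∧ latticeGraphIso σ ϖ ((StdForm.antidiagonal 3).over K) n (A 1) = y := by
  have hϖ0 : ϖ ≠ 0 := uniformizer_ne_zero hd.vϖ
  have hϖ1 : Valued.v ϖ ≤ 1 := v_le_one_of_v_eq_exp_neg_one hd.vϖ
  have hlt1 : ∀ z : K, Valued.v z < 1 ↔ Valued.v z ≤ Valued.v ϖ := fun z => by rw [hd.vϖ]; exact v_lt_one_iff z
  have hA0' : (A 0).1 = stdLattice K 3 := coe_apartmentEnum_zero A hA0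
  have hAm1 : (A (-1)).1 = latt (Matrix.diagonal ![(1 : K), 1, ϖ]) := by
    have h := hA1 (-1)
    rw [show (2 : ℤ) * (-1) + 1 = -1 by norm_num, show (-1 : ℤ) + 1 = 0 by norm_num, neg_neg, zpow_zero, zpow_one] at h
    exact h
  have hA1' : (A 1).1 = latt (Matrix.diagonal ![ϖ, (1 : K), 1]) := by
    have h := hA1 0
    rw [show (2 : ℤ) * 0 + 1 = 1 by norm_num, zero_add, neg_zero, zpow_zero, zpow_one] at h
    exact h
  -- ★ V2a: `y = N_x`
  have hroot : A 0 = ⟨stdLattice K 3, 0, isSelfDualLattice_stdLattice_three hd⟩ := Subtype.ext hA0'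
  have hw : y ∈ (latticeGraph σ ϖ ((StdForm.antidiagonal 3).over K)).neighborSet ⟨stdLattice K 3, 0, isSelfDualLattice_stdLattice_three hd⟩ := by
    rw [SimpleGraph.mem_neighborSet, ← hroot]; exact hy
  obtain ⟨x, hxint, ⟨j, hxj⟩, hxiso, hmem⟩ := exists_isotropic_forall_mem_iff_of_mem_neighborSet_root hd hw
  have hxiso' : σ (x 0) * x 2 + σ (x 1) * x 1 + σ (x 2) * x 0 = 0 := by rw [← B₀_three_apply]; exact hxiso
  have hx : ∀ i, Valued.v (x i) ≤ 1 := hxint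
  by_cases h2 : Valued.v (x 2) < 1
  · -- `|x₂| < 1`: then `y = A (−1)`, excluded
    exfalso; apply hy'
    have hx1 : Valued.v (x 1) < 1 := by
      have h : σ (x 1) * x 1 = -(σ (x 0) * x 2 + σ (x 2) * x 0) := by linear_combination hxiso'
      have hv : Valued.v (σ (x 1) * x 1) < 1 := by
        rw [h, Valuation.map_neg]
        refine (Valuation.map_add _ _ _).trans_lt (max_lt ?_ ?_)
        · rw [map_mul, hd.vσ]
          calc Valued.v (x 0) * Valued.v (x 2) ≤ 1 * Valued.v (x 2) := mul_le_mul_left (hx 0) _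
            _ < 1 := by rw [one_mul]; exact h2
        · rw [map_mul, hd.vσ]
          calc Valued.v (x 2) * Valued.v (x 0) ≤ Valued.v (x 2) * 1 := mul_le_mul_right (hx 0) _
            _ < 1 := by rw [mul_one]; exact h2
      rw [map_mul, hd.vσ] at hv
      by_contra hge
      have h1 : Valued.v (x 1) = 1 := le_antisymm (hx 1) (not_lt.1 hge)
      rw [h1, mul_one] at hv
      exact lt_irrefl _ hv
    have hx0 : Valued.v (x 0) = 1 := by
      fin_cases j
      · exact hxj
      · exact absurd hxj hx1.ne
      · exact absurd hxj h2.ne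
    apply Subtype.ext
    rw [hAm1]
    ext y'
    have hdiag : ∀ i, (![(1 : K), 1, ϖ] : Fin 3 → K) i ≠ 0 := by intro i; fin_cases i <;> simp [hϖ0]
    rw [hmem, mem_latt_diagonal_iff hdiag, Fin.forall_fin_succ, Fin.forall_fin_two, B₀_three_apply]
    simp only [Fin.succ_zero_eq_one, Fin.succ_one_eq_two, Matrix.cons_val_zero, Matrix.cons_val_one, Matrix.cons_val_two, Matrix.tail_cons, Matrix.head_cons, map_one]
    constructor
    · rintro ⟨hy'int, hB⟩
      have hi : ∀ i, Valued.v (y' i) ≤ 1 := hy'int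
      refine ⟨hi 0, hi 1, (hlt1 _).1 ?_⟩
      -- `|y₂| < 1`: `σx₀ y₂ = B₀ − σx₁ y₁ − σx₂ y₀` with `|σx₀| = 1`
      have h : σ (x 0) * y' 2 = (σ (x 0) * y' 2 + σ (x 1) * y' 1 + σ (x 2) * y' 0) - σ (x 1) * y' 1 - σ (x 2) * y' 0 := by ring
      have hv : Valued.v (σ (x 0) * y' 2) < 1 := by
        rw [h]
        refine (Valuation.map_sub _ _ _).trans_lt (max_lt ((Valuation.map_sub _ _ _).trans_lt (max_lt hB ?_)) ?_)
        · rw [map_mul, hd.vσ]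
          calc Valued.v (x 1) * Valued.v (y' 1) ≤ Valued.v (x 1) * 1 := mul_le_mul_right (hi 1) _
            _ < 1 := by rw [mul_one]; exact hx1
        · rw [map_mul, hd.vσ]
          calc Valued.v (x 2) * Valued.v (y' 0) ≤ Valued.v (x 2) * 1 := mul_le_mul_right (hi 0) _
            _ < 1 := by rw [mul_one]; exact h2
      rwa [map_mul, hd.vσ, hx0, one_mul] at hv
    · rintro ⟨h0, h1, h2'⟩
      have hi : ∀ i, Valued.v (y' i) ≤ 1 := by
        intro i; fin_cases i
        · exact h0
        · exact h1
        · exact h2'.trans hϖ1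
      refine ⟨hi, ?_⟩
      refine (Valuation.map_add _ _ _).trans_lt (max_lt ((Valuation.map_add _ _ _).trans_lt (max_lt ?_ ?_)) ?_)
      · rw [map_mul, hd.vσ, hx0, one_mul]; exact (hlt1 _).2 h2'
      · rw [map_mul, hd.vσ]
        calc Valued.v (x 1) * Valued.v (y' 1) ≤ Valued.v (x 1) * 1 := mul_le_mul_right (hi 1) _
          _ < 1 := by rw [mul_one]; exact hx1
      · rw [map_mul, hd.vσ]
        calc Valued.v (x 2) * Valued.v (y' 0) ≤ Valued.v (x 2) * 1 := mul_le_mul_right (hi 0) _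
          _ < 1 := by rw [mul_one]; exact h2
  · -- `|x₂| = 1`: the Heisenberg element with last column `x ∕ x₂`
    have hx2 : Valued.v (x 2) = 1 := le_antisymm (hx 2) (not_lt.1 h2)
    have hx2' : x 2 ≠ 0 := fun h => by rw [h, map_zero] at hx2; exact zero_ne_one hx2
    have hσx2 : σ (x 2) ≠ 0 := (map_ne_zero σ).2 hx2'
    have hvσx2 : Valued.v (σ (x 2)) = 1 := by rw [hd.vσ, hx2]
    set a : K := -σ (x 1 / x 2) with ha
    set b : K := x 0 / x 2 with hb
    set c : K := x 1 / x 2 with hc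
    have hva : Valued.v a ≤ 1 := by rw [ha, Valuation.map_neg, hd.vσ, map_div₀, hx2, div_one]; exact hx 1
    have hvb : Valued.v b ≤ 1 := by rw [hb, map_div₀, hx2, div_one]; exact hx 0
    have hvc : Valued.v c ≤ 1 := by rw [hc, map_div₀, hx2, div_one]; exact hx 1
    have hσa : σ a = -c := by rw [ha, map_neg, hd.σσ]
    have hcσ : c = -σ a := by rw [hσa, neg_neg]
    have hrel : b + σ b + a * σ a = 0 := by
      rw [hσa, ha, hb, hc, map_div₀, map_div₀]
      field_simp
      linear_combination hxiso'
    have hacb : a * c - b = σ b := by linear_combination (-1 : K) * hrel + a * hcσ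
    have hvacb : Valued.v (a * c - b) ≤ 1 := by rw [hacb, hd.vσ]; exact hvb
    -- the element
    let nM : Matrix (Fin 3) (Fin 3) K := !![1, a, b; 0, 1, c; 0, 0, 1]
    let nMi : Matrix (Fin 3) (Fin 3) K := !![1, -a, a * c - b; 0, 1, -c; 0, 0, 1]
    have hmul : nM * nMi = 1 := by
      ext i j; fin_cases i <;> fin_cases j <;> simp [nM, nMi, Matrix.mul_apply, Fin.sum_univ_three]; ring
    have hmul' : nMi * nM = 1 := by
      ext i j; fin_cases i <;> fin_cases j <;> simp [nM, nMi, Matrix.mul_apply, Fin.sum_univ_three]; ring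
    let nG : GL (Fin 3) K := ⟨nM, nMi, hmul, hmul'⟩
    have hnU : nG ∈ unitaryGroupOfForm σ ((StdForm.antidiagonal 3).over K) :=
      (mem_unitaryGroupOfForm_iff_of_coe_eq_upperUnipotent σ hd.σσ (u := nG) rfl).2 ⟨hcσ, hrel⟩
    refine ⟨⟨nG, hnU⟩, ?_, ?_, ?_⟩
    · rw [mem_unipotentU_iff]
      refine ⟨?_, fun i => ?_⟩
      · intro i j hij
        change (j : Fin 3) < i at hij
        change nM i j = 0
        fin_cases i <;> fin_cases j <;> simp [nM] at hij ⊢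
      · change nM i i = 1
        fin_cases i <;> simp [nM]
    · -- `n` fixes the root
      apply Subtype.ext
      change mapGL nG (A 0).1 = (A 0).1
      rw [hA0', mapGL_stdLattice_eq_iff]
      refine ⟨fun i j => ?_, fun i j => ?_⟩
      · change Valued.v (nM i j) ≤ 1
        fin_cases i <;> fin_cases j <;> simp [nM, hva, hvb, hvc]
      · change Valued.v (nMi i j) ≤ 1
        fin_cases i <;> fin_cases j <;> simp [nMi, Valuation.map_neg, hva, hvc, hvacb]
    · -- `n · A 1 = y`
      apply Subtype.ext
      change mapGL nG (A 1).1 = y.1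
      rw [hA1']
      ext y'
      have hdiag : ∀ i, (![ϖ, (1 : K), 1] : Fin 3 → K) i ≠ 0 := by intro i; fin_cases i <;> simp [hϖ0]
      obtain ⟨e0, e1, e2⟩ := upperUnipotent_mulVec (-a) (a * c - b) (-c) y'
      have key : nMi.mulVec y' 0 = (σ (x 2))⁻¹ * B₀ σ 3 x y' := by
        change (!![1, -a, a * c - b; 0, 1, -c; 0, 0, 1] : Matrix (Fin 3) (Fin 3) K).mulVec y' 0 = _
        rw [e0, B₀_three_apply, hacb, ha, hb, hc, map_div₀, map_div₀]
        field_simp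
        ring
      have e1' : nMi.mulVec y' 1 = y' 1 - c * y' 2 := by
        change (!![1, -a, a * c - b; 0, 1, -c; 0, 0, 1] : Matrix (Fin 3) (Fin 3) K).mulVec y' 1 = _
        rw [e1]; ring
      have e2' : nMi.mulVec y' 2 = y' 2 := e2
      rw [mem_mapGL_iff, hmem y', B₀_three_apply]
      change nMi.mulVec y' ∈ latt (Matrix.diagonal ![ϖ, (1 : K), 1]) ↔ _
      rw [mem_latt_diagonal_iff hdiag, Fin.forall_fin_succ, Fin.forall_fin_two]
      simp only [Fin.succ_zero_eq_one, Fin.succ_one_eq_two, Matrix.cons_val_zero, Matrix.cons_val_one, Matrix.cons_val_two, Matrix.tail_cons, Matrix.head_cons, map_one]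
      rw [key, e1', e2', B₀_three_apply, map_mul, map_inv₀, hvσx2, inv_one, one_mul]
      constructor
      · rintro ⟨h0, h1, h2'⟩
        have hy1 : Valued.v (y' 1) ≤ 1 := by
          have e : y' 1 = (y' 1 - c * y' 2) + c * y' 2 := by ring
          rw [e]; exact v_add_le_one_of_le h1 (v_mul_le_one_of_le hvc h2')
        have hy0 : Valued.v (y' 0) ≤ 1 := by
          have e : y' 0 = (σ (x 2))⁻¹ * (σ (x 0) * y' 2 + σ (x 1) * y' 1 + σ (x 2) * y' 0) - -a * y' 1 - (a * c - b) * y' 2 := by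
            rw [hacb, ha, hb, hc, map_div₀, map_div₀]; field_simp; ring
          rw [e]
          refine v_sub_le_one_of_le (v_sub_le_one_of_le ?_ (v_mul_le_one_of_le (by rw [Valuation.map_neg]; exact hva) hy1)) (v_mul_le_one_of_le hvacb h2')
          rw [map_mul, map_inv₀, hvσx2, inv_one, one_mul]; exact h0.trans hϖ1
        refine ⟨?_, (hlt1 _).2 h0⟩
        intro i; fin_cases i
        · exact hy0
        · exact hy1
        · exact h2'
      · rintro ⟨hi, hB⟩
        have hi' : ∀ i, Valued.v (y' i) ≤ 1 := hi
        exact ⟨(hlt1 _).1 hB, v_sub_le_one_of_le (hi' 1) (v_mul_le_one_of_le hvc (hi' 2)), hi' 2⟩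

end Enum

end Literature.NumberTheory.Automorphic.UnitaryLatticeTree
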